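import Mathlib
import HarnessLib
import Summits.HubbardSuperconductivity.HubbardSuperconductivity.Theorems.ComplexGFFStiffnessHypACumulantInitialNormLE
import Literature.MathematicalPhysics.StatisticalMechanics.WeightedNormDomination

/-!
# Line `gnv`, stub `stub_gnvOfFrd`: the scale-`0` weight is dominated along any Gaussian-type
# fluctuation measure, and the first integration step of the initial activity is bounded
# (ABKM19 Lemma 8.4 at `k = 0` for the `ι`-admissible complex class, modulo Theorem 7.1 (w7))

The weighted-norm interface (`GradientRG.TayNormLE`, `WeightedNormBounds.lean`) bounds the Gaussian
integration map `R K = ∫ K(· + ξ) μ(dξ)` from two weight-level hypotheses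
(`TayNormLE.integral_comp_add'`, `WeightedNormDomination.lean`): the INTEGRATION PROPERTY
`∫ w(φ+ξ) μ(dξ) ≤ A w'(φ)` ([ABKM19] Theorem 7.1 (w7)) and the LOCAL DOMINATION `WeightDominated T w μ`.
For the scale-`0` weight of the line, `w_X(φ) = exp(¼ Σ_{x∈X} |∇φ(x)|²)` (the weight of
`IsIotaAdmissible`, [ABKM19] (12.13)), this file proves the domination from a moment condition on
`μ` and concludes the first integration step for the initial activity `I(K)(X) = ∏_{x∈X} K(∇φ(x))`:

* `sq_add_le_young` — `(a+b)² ≤ t b² + (t/(t−1)) a²` (`t > 1`);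
* `sumSqGrad_add_le` — Young's inequality for `Q_X(φ) = Σ_{x∈X}|∇φ(x)|²`:
  `Q_X(φ+ξ) ≤ t Q_X(ξ) + (t/(t−1)) Q_X(φ)`; `sumSqGrad_le_gauge` — `Q_X(φ) ≤ 4|X|(𝔥/R)²‖Tφ‖²`
  for the gauge `T = fieldGauge 𝔥 R p S`, `X ⊆ S`;
* **`weightDominated_pertWeight`** — if `exp((t/4) Q_X)` is `μ`-integrable for some `t > 1`
  (every centred Gaussian `μ` subcritical for `Q_X` with a margin), then
  `WeightDominated T w_X μ`;
* **`tayNormLE_integral_pertActivity`** — [ABKM19] Lemma 8.4 (`ℓ = 0`) for the initial activity: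
  `‖∫ I(K)(X)(· + ξ) μ(dξ)‖_{T,w'} ≤ (ρ e^{𝔥/R})^{|X|} · A` whenever `∫ w_X(φ+ξ) μ(dξ) ≤ A w'(φ)`
  (the (w7) bound, supplied for Gaussian `μ` by `GradientRG.integral_exp_half_quadForm_shift_le`).
-/

noncomputable section

-- `Summit.<Summit>.<Problem>`: single-conjunct summit, the duplicate component is mandated (D-0017).
set_option linter.dupNamespace false

namespace Summit.HubbardSuperconductivity.HubbardSuperconductivity.Theorems.ComplexGFF

open Finset MeasureTheory
open Literature.MathematicalPhysics.StatisticalMechanics.ComplexGradientGFF4 (D)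
open Literature.MathematicalPhysics.StatisticalMechanics.GradientRG
  (fieldGauge gradAt tayNorm TayNormLE WeightDominated norm_gradAt_le_gauge)

variable {n : ℕ}

/-- **Young's inequality for squares**: `(a + b)² ≤ t·b² + (t/(t−1))·a²` for `t > 1`. -/
theorem sq_add_le_young {t : ℝ} (ht : 1 < t) (a b : ℝ) :
    (a + b) ^ 2 ≤ t * b ^ 2 + t / (t - 1) * a ^ 2 := by
  have ht1 : 0 < t - 1 := by linarith
  have key : 0 ≤ ((t - 1) * b - a) ^ 2 / (t - 1) := div_nonneg (sq_nonneg _) ht1.le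
  have hid : t * b ^ 2 + t / (t - 1) * a ^ 2 - (a + b) ^ 2 = ((t - 1) * b - a) ^ 2 / (t - 1) := by
    field_simp
    ring
  linarith [hid ▸ key]

/-- The gradient is additive in the field: `∇(φ + ξ) = ∇φ + ∇ξ`. -/
theorem D_add_field (φ ξ : (Fin 4 → ZMod n) → ℝ) (i : Fin 4) (x : Fin 4 → ZMod n) :
    D (φ + ξ) i x = D φ i x + D ξ i x := by
  simp only [D, Pi.add_apply]
  ring

/-- **Young's inequality for `Q_X(φ) = Σ_{x∈X} |∇φ(x)|²`**:
`Q_X(φ + ξ) ≤ t Q_X(ξ) + (t/(t−1)) Q_X(φ)` for `t > 1`. -/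
theorem sumSqGrad_add_le {t : ℝ} (ht : 1 < t) (X : Finset (Fin 4 → ZMod n))
    (φ ξ : (Fin 4 → ZMod n) → ℝ) :
    ∑ x ∈ X, ∑ i : Fin 4, (D (φ + ξ) i x) ^ 2 ≤
      t * ∑ x ∈ X, ∑ i : Fin 4, (D ξ i x) ^ 2 +
        t / (t - 1) * ∑ x ∈ X, ∑ i : Fin 4, (D φ i x) ^ 2 := by
  rw [Finset.mul_sum, Finset.mul_sum, ← Finset.sum_add_distrib]
  refine Finset.sum_le_sum fun x _ => ?_
  rw [Finset.mul_sum, Finset.mul_sum, ← Finset.sum_add_distrib]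
  refine Finset.sum_le_sum fun i _ => ?_
  rw [D_add_field]
  exact sq_add_le_young ht _ _

/-- **`Q_X` is controlled by the gauge**: `Σ_{x∈X} |∇φ(x)|² ≤ 4|X| (𝔥/R)² ‖Tφ‖²` for
`T = fieldGauge 𝔥 R p S`, `X ⊆ S`, `p ≥ 1`. -/
theorem sumSqGrad_le_gauge [NeZero n] {𝔥 R : ℝ} (h𝔥 : 0 < 𝔥) (hR : 0 < R) {p : ℕ} (hp : 1 ≤ p)
    {S X : Finset (Fin 4 → ZMod n)} (hXS : X ⊆ S) (φ : (Fin 4 → ZMod n) → ℝ) :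
    ∑ x ∈ X, ∑ i : Fin 4, (D φ i x) ^ 2 ≤
      4 * X.card * ((𝔥 / R) * ‖fieldGauge 𝔥 R p S φ‖) ^ 2 := by
  have hterm : ∀ x ∈ X, ∑ i : Fin 4, (D φ i x) ^ 2 ≤ 4 * ((𝔥 / R) * ‖fieldGauge 𝔥 R p S φ‖) ^ 2 := by
    intro x hx
    have hg := norm_gradAt_le_gauge h𝔥 hR hp (hXS hx) φ
    have hi : ∀ i : Fin 4, (D φ i x) ^ 2 ≤ ((𝔥 / R) * ‖fieldGauge 𝔥 R p S φ‖) ^ 2 := by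
      intro i
      have h1 : |D φ i x| ≤ ‖gradAt x φ‖ := by
        have := norm_le_pi_norm (gradAt x φ) i
        rwa [Real.norm_eq_abs] at this
      have h2 : |D φ i x| ≤ (𝔥 / R) * ‖fieldGauge 𝔥 R p S φ‖ := h1.trans hg
      calc (D φ i x) ^ 2 = |D φ i x| ^ 2 := (sq_abs _).symm
        _ ≤ ((𝔥 / R) * ‖fieldGauge 𝔥 R p S φ‖) ^ 2 :=
            pow_le_pow_left₀ (abs_nonneg _) h2 2
    calc ∑ i : Fin 4, (D φ i x) ^ 2 ≤ ∑ _i : Fin 4, ((𝔥 / R) * ‖fieldGauge 𝔥 R p S φ‖) ^ 2 :=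
          Finset.sum_le_sum fun i _ => hi i
      _ = 4 * ((𝔥 / R) * ‖fieldGauge 𝔥 R p S φ‖) ^ 2 := by
          rw [Finset.sum_const, Finset.card_univ, Fintype.card_fin, nsmul_eq_mul, Nat.cast_ofNat]
  calc ∑ x ∈ X, ∑ i : Fin 4, (D φ i x) ^ 2
      ≤ ∑ _x ∈ X, 4 * ((𝔥 / R) * ‖fieldGauge 𝔥 R p S φ‖) ^ 2 := Finset.sum_le_sum hterm
    _ = 4 * X.card * ((𝔥 / R) * ‖fieldGauge 𝔥 R p S φ‖) ^ 2 := by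
        rw [Finset.sum_const, nsmul_eq_mul]; ring

/-- **The scale-`0` weight is dominated along `μ`**: if `exp((t/4)·Q_X)` is `μ`-integrable for some
`t > 1`, then `WeightDominated (fieldGauge 𝔥 R p S) w_X μ` for `w_X(φ) = exp(¼ Q_X(φ))`, `X ⊆ S`:
locally in the field (gauge distance `< 1` from `φ₀`),
`w_X(φ + ξ) ≤ exp((t/(t−1)) |X| (𝔥/R)² (‖Tφ₀‖+1)²) · exp((t/4) Q_X(ξ))` (Young). -/
theorem weightDominated_pertWeight [NeZero n] {𝔥 R : ℝ} (h𝔥 : 0 < 𝔥) (hR : 0 < R) {p : ℕ}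
    (hp : 1 ≤ p) {S X : Finset (Fin 4 → ZMod n)} (hXS : X ⊆ S)
    {μ : Measure ((Fin 4 → ZMod n) → ℝ)} {t : ℝ} (ht : 1 < t)
    (hint : Integrable (fun ξ : (Fin 4 → ZMod n) → ℝ =>
      Real.exp (t / 4 * ∑ x ∈ X, ∑ i : Fin 4, (D ξ i x) ^ 2)) μ) :
    WeightDominated (fieldGauge 𝔥 R p S)
      (fun φ : (Fin 4 → ZMod n) → ℝ => Real.exp ((∑ x ∈ X, ∑ i : Fin 4, (D φ i x) ^ 2) / 4)) μ := by
  intro φ₀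
  set T := fieldGauge 𝔥 R p S with hT
  set B : ℝ := t / (t - 1) / 4 * (4 * X.card * ((𝔥 / R) * (‖T φ₀‖ + 1)) ^ 2) with hB
  refine ⟨1, one_pos, fun ξ => Real.exp B * Real.exp (t / 4 * ∑ x ∈ X, ∑ i : Fin 4, (D ξ i x) ^ 2),
    hint.const_mul _, fun ξ φ hφ => ?_⟩
  have ht1 : 0 < t / (t - 1) := div_pos (by linarith) (by linarith)
  -- the field is gauge-close to `φ₀`: `‖Tφ‖ ≤ ‖Tφ₀‖ + 1`
  have hTφ : ‖T φ‖ ≤ ‖T φ₀‖ + 1 := by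
    have h := norm_add_le (T φ₀) (T (φ - φ₀))
    rw [← map_add, add_sub_cancel] at h
    linarith [hφ.le]
  have hQφ : ∑ x ∈ X, ∑ i : Fin 4, (D φ i x) ^ 2 ≤ 4 * X.card * ((𝔥 / R) * (‖T φ₀‖ + 1)) ^ 2 := by
    refine (sumSqGrad_le_gauge h𝔥 hR hp hXS φ).trans ?_
    have h0 : 0 ≤ (𝔥 / R) * ‖T φ‖ := mul_nonneg (div_nonneg h𝔥.le hR.le) (norm_nonneg _)
    have h1 : (𝔥 / R) * ‖T φ‖ ≤ (𝔥 / R) * (‖T φ₀‖ + 1) :=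
      mul_le_mul_of_nonneg_left hTφ (div_nonneg h𝔥.le hR.le)
    have : ((𝔥 / R) * ‖T φ‖) ^ 2 ≤ ((𝔥 / R) * (‖T φ₀‖ + 1)) ^ 2 := pow_le_pow_left₀ h0 h1 2
    have hc : (0 : ℝ) ≤ 4 * X.card := by positivity
    exact mul_le_mul_of_nonneg_left this hc
  show Real.exp ((∑ x ∈ X, ∑ i : Fin 4, (D (φ + ξ) i x) ^ 2) / 4) ≤
    Real.exp B * Real.exp (t / 4 * ∑ x ∈ X, ∑ i : Fin 4, (D ξ i x) ^ 2)
  rw [← Real.exp_add]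
  refine Real.exp_le_exp.2 ?_
  have hy := sumSqGrad_add_le ht X φ ξ
  have hQ0 : 0 ≤ ∑ x ∈ X, ∑ i : Fin 4, (D φ i x) ^ 2 :=
    Finset.sum_nonneg fun _ _ => Finset.sum_nonneg fun _ _ => sq_nonneg _
  calc (∑ x ∈ X, ∑ i : Fin 4, (D (φ + ξ) i x) ^ 2) / 4
      ≤ (t * ∑ x ∈ X, ∑ i : Fin 4, (D ξ i x) ^ 2 +
          t / (t - 1) * ∑ x ∈ X, ∑ i : Fin 4, (D φ i x) ^ 2) / 4 := by
        exact div_le_div_of_nonneg_right hy (by norm_num)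
    _ ≤ (t * ∑ x ∈ X, ∑ i : Fin 4, (D ξ i x) ^ 2 +
          t / (t - 1) * (4 * X.card * ((𝔥 / R) * (‖T φ₀‖ + 1)) ^ 2)) / 4 := by
        gcongr
    _ = B + t / 4 * ∑ x ∈ X, ∑ i : Fin 4, (D ξ i x) ^ 2 := by
        rw [hB]; ring

/-- The polymer activity of a `C^{r₀}` perturbation is `C^{r₀}` in the field. -/
theorem contDiff_pertActivity [NeZero n] {r₀ : ℕ} {K : (Fin 4 → ℝ) → ℂ} (hK : ContDiff ℝ r₀ K)
    (X : Finset (Fin 4 → ZMod n)) :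
    ContDiff ℝ r₀ (fun φ : (Fin 4 → ZMod n) → ℝ => ∏ x ∈ X, K (fun i => D φ i x)) :=
  contDiff_prod fun x _ => contDiff_pertSite hK x

/-- **[ABKM19] Lemma 8.4 (`ℓ = 0`) for the initial activity of an `ι`-admissible perturbation,
modulo Theorem 7.1 (w7)**: let `K` satisfy `IsIotaAdmissible r₀ ρ K`, `X ⊆ S`, `T = fieldGauge 𝔥 R p S`
(`𝔥, R > 0`, `p ≥ 1`), and let `μ` be a measure on fields for which the scale-`0` weight
`w_X = exp(¼ Q_X)` has a `t`-moment (`t > 1`), `w_X(φ + ·)` is integrable, and the INTEGRATION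
PROPERTY `∫ w_X(φ + ξ) μ(dξ) ≤ A · w'(φ)` holds.  Then the fluctuation integral of the activity is in
the weighted ball of the new weight: `‖∫ I(K)(X)(· + ξ) μ(dξ)‖_{T,w'} ≤ (ρ e^{𝔥/R})^{|X|} · A`. -/
theorem tayNormLE_integral_pertActivity [NeZero n] {r₀ : ℕ} {ρ : ℝ} {K : (Fin 4 → ℝ) → ℂ}
    (hK : IsIotaAdmissible r₀ ρ K) (hρ : 0 ≤ ρ) {𝔥 R : ℝ} (h𝔥 : 0 < 𝔥) (hR : 0 < R) {p : ℕ}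
    (hp : 1 ≤ p) {S X : Finset (Fin 4 → ZMod n)} (hXS : X ⊆ S)
    {μ : Measure ((Fin 4 → ZMod n) → ℝ)} {t : ℝ} (ht : 1 < t)
    (hint : Integrable (fun ξ : (Fin 4 → ZMod n) → ℝ =>
      Real.exp (t / 4 * ∑ x ∈ X, ∑ i : Fin 4, (D ξ i x) ^ 2)) μ)
    (hwint : ∀ φ : (Fin 4 → ZMod n) → ℝ, Integrable (fun ξ : (Fin 4 → ZMod n) → ℝ =>
      Real.exp ((∑ x ∈ X, ∑ i : Fin 4, (D (φ + ξ) i x) ^ 2) / 4)) μ)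
    {w' : ((Fin 4 → ZMod n) → ℝ) → ℝ} {A : ℝ}
    (hw : ∀ φ : (Fin 4 → ZMod n) → ℝ,
      ∫ ξ, Real.exp ((∑ x ∈ X, ∑ i : Fin 4, (D (φ + ξ) i x) ^ 2) / 4) ∂μ ≤ A * w' φ) :
    TayNormLE (fieldGauge 𝔥 R p S) r₀ w'
      (fun ψ : (Fin 4 → ZMod n) → ℝ => ∫ ξ, (∏ x ∈ X, K (fun i => D (ψ + ξ) i x)) ∂μ)
      ((ρ * Real.exp (𝔥 / R)) ^ X.card * A) :=
  (tayNormLE_pertActivity hK h𝔥 hR hp hXS).integral_comp_add'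
    (pow_nonneg (mul_nonneg hρ (Real.exp_pos _).le) _) (contDiff_pertActivity hK.1 X)
    (isGaugeLocal_pertActivity K h𝔥 hR hp hXS) (weightDominated_pertWeight h𝔥 hR hp hXS ht hint)
    hwint hw

end Summit.HubbardSuperconductivity.HubbardSuperconductivity.Theorems.ComplexGFF

end
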